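import Summits.QuantumFields.YangMills.Theorems.BalabanUVNodesN08AlphaLiftAvgCont

/-!
# Route «BalabanUVNodes», Track-A DAG node N08 = [Balaban1985UV3] — (α) clause, (b7) AT ALL SCALES BY CONSTRUCTION: the ADAPTED CLASS of
# configurations whose iterated `log`-arguments stay in the domain of (21) — open (resp. closed) by induction on the scale, contains `1`, and ON IT
# every lifted `j`-fold average of [4] is continuous

Cell `pub-ymgap`, seat `pub-ymgap-dag-n08-d` gen 4, file 9 (director-ym R134 row «CLASS-I in-edge conclusions at the (α) granularity of `RunAlpha`»).
`bears_on: R4∕N08`; filed `--supports stmt-QuantumFields-19903 --as helper`.  Sorry-free, standard axioms.  Builds on file 8 (`…N08AlphaLiftAvgCont`: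
translations ∕ periodicity ∕ continuity-at-a-point of [4]'s (42)–(43)).

THE IDEA.  Files 3–7 display (b7) «the lifted averages `U ↦ Ū^j(lift U)` are continuous on the selection class» because the series (21) of [4] converges
only on small loop variables.  Instead of proving smallness on [7]'s class region by region ([4] Props. 1–2 local form), ADAPT THE CLASS: let
`logArgDev 𝔊 i U (q, κ, r) = |Ū^i(lift U)(Γ_{c,x})Ū^i(lift U)(c)⁻¹ − 1|` (the `log`-arguments of the `(i+1)`-st averaging) and
`argClass 𝔊 k = {U | logArgDev i U < ½ for all i < k and all loops}` (`argClassC`: `≤ ¼`).  Then, by induction on `k`: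
* on `argClass 𝔊 k` every bond variable of `Ū^k(lift U)` is continuous AT each member (file 8's `continuousAt_val_avgIter_succ`), hence so is
  `logArgDev k` (`continuousAt_logArgDev`);
* the level-`k` conditions are finitely many modulo the PERIOD `sitesPerDir k` of the averaged lift (file 8; `forall_site_iff_box`), so
  `argClass 𝔊 (k+1) = argClass 𝔊 k ∩ ⋂_{finite} {logArgDev k < ½}` is OPEN (`ContinuousOn.isOpen_inter_preimage`) and `argClassC 𝔊 (k+1)` is CLOSED
  (`ContinuousOn.preimage_isClosed_of_isClosed`) — ★ `isOpen_argClass`, ★ `isClosed_argClassC` (`k ≤ m + K + 1`);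
* `1 ∈ argClassC ⊆ argClass` (`Ū^i(1) = 1`, tree `B7Eq92Concrete.avgIter_one`);
* ★ `continuousOn_val_liftAvg_argClass`: for `j < k`, every `U ↦ Ū^j(lift U)(z, κ)` is continuous ON `argClass 𝔊 k` — the hypothesis `hcont` of files
  3∕6 HOLDS on any selection class inside `argClass 𝔊 k`, with no window and at every scale (file 10 runs the selection there).
HONEST FRAMING: kernel topology over [4]'s definitions; nothing of [B10] ∕ [7] ∕ [4]'s estimates asserted (in particular NOT that print's minimiser lies in
the adapted class — that becomes part of file 10's non-emptiness hypothesis); count-neutral; NOT a discharge of N08.  d = 3 lattice gauge theory on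
finite tori as printed; nothing about d = 4, the continuum, OS axioms, a mass gap or the Clay problem.
-/

noncomputable section

namespace Summit.QuantumFields.YangMills.Theorems.BalabanUVNodesN08AlphaArgClass

open Set Topology TopologicalSpace
open scoped Matrix Matrix.Norms.L2Operator BigOperators
open Literature.MathematicalPhysics.QuantumFieldTheory.Balaban1983to89
open Literature.MathematicalPhysics.QuantumFieldTheory.Balaban1985CMP102.Setting
open Summit.QuantumFields.Balaban3D.Proofs.LiftBridge (liftCfg)
open Summit.QuantumFields.Balaban3D.Proofs.TorusLift (projSite)
open Summit.QuantumFields.YangMills.Theorems.BalabanUVNodesN08AlphaGroupTopology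
open Summit.QuantumFields.YangMills.Theorems.BalabanUVNodesN08AlphaLiftAvgCont
open B7Prop1Explicit (hol stepHol Letter Wcx boxVec hol_nil hol_cons Wcx_eq_hol_loop)
open B7Prop2Explicit (avgIter avgIter_zero)

variable {L : ℕ} {S : Scales L} {G : Type} [GaugeGroup G] [MeasurableSpace G] (𝔊 : GroupModel G)

/-! ## §1 The `log`-argument deviations and the adapted classes -/

/-- **THE `log`-ARGUMENT DEVIATION AT LEVEL `i`**: `|Ū^i(lift U)(Γ_{c,x})·Ū^i(lift U)(c)⁻¹ − 1|` for the `L`-bond `c = (q, q + Le_κ)` of the level-`i`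
lattice and `x = q + r ∈ B(c₋)` — the quantity that must be `< 1` for the series (21) defining `Ū^{i+1}` ((42)–(43)) to converge.
[cite: Balaban1985Averaging, (21) p.21 + (42)–(43) pp.23–24] -/
def logArgDev (i : ℕ) (U : GaugeField S.P 0 G) (q : B7Prop1Explicit.Site S.P.d) (κ : Fin S.P.d) (r : Fin S.P.d → Fin L) : ℝ :=
  ‖((Wcx L (avgIter L (liftCfg 𝔊 U) i) q κ (boxVec L r) : (Matrix (Fin 𝔊.N) (Fin 𝔊.N) ℂ)ˣ) : Matrix (Fin 𝔊.N) (Fin 𝔊.N) ℂ) - 1‖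

/-- **THE ADAPTED (OPEN) CLASS**: all `log`-argument deviations of the levels `i < k` are `< ½`. [cite: Balaban1985Averaging, (21) p.21 + (42)–(43) pp.23–24] -/
def argClass (k : ℕ) : Set (GaugeField S.P 0 G) :=
  {U | ∀ i < k, ∀ (q : B7Prop1Explicit.Site S.P.d) (κ : Fin S.P.d) (r : Fin S.P.d → Fin L), logArgDev 𝔊 i U q κ r < 1 / 2}

/-- **THE ADAPTED CLOSED CLASS**: all `log`-argument deviations of the levels `i < k` are `≤ ¼`. [cite: Balaban1985Averaging, (21) p.21 + (42)–(43) pp.23–24] -/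
def argClassC (k : ℕ) : Set (GaugeField S.P 0 G) :=
  {U | ∀ i < k, ∀ (q : B7Prop1Explicit.Site S.P.d) (κ : Fin S.P.d) (r : Fin S.P.d → Fin L), logArgDev 𝔊 i U q κ r ≤ 1 / 4}

/-- The closed class lies inside the open class. [folklore] -/
theorem argClassC_subset_argClass (k : ℕ) : argClassC 𝔊 k ⊆ (argClass 𝔊 k : Set (GaugeField S.P 0 G)) :=
  fun _ hU i hi q κ r => (hU i hi q κ r).trans_lt (by norm_num)

/-- The classes decrease in `k`. [folklore] -/
theorem argClass_mono {k k' : ℕ} (h : k ≤ k') : argClass 𝔊 k' ⊆ (argClass 𝔊 k : Set (GaugeField S.P 0 G)) :=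
  fun _ hU i hi => hU i (lt_of_lt_of_le hi h)

/-! ## §2 Continuity at the members of the class -/

/-- **ON A CONFIGURATION WHOSE DEVIATIONS OF LEVELS `< i` ARE `< 1`, EVERY BOND VARIABLE OF `Ū^i(lift ·)` IS CONTINUOUS AT IT** (induction on `i` with file
8's `continuousAt_val_avgIter_succ`; level `0` is the lift, continuous everywhere). [cite: Balaban1985Averaging, (42)–(43) pp.23–24] -/
theorem continuousAt_val_liftAvg : ∀ (i : ℕ) (U₀ : GaugeField S.P 0 G),
    (∀ i' < i, ∀ (q : B7Prop1Explicit.Site S.P.d) (κ : Fin S.P.d) (r : Fin S.P.d → Fin L), logArgDev 𝔊 i' U₀ q κ r < 1) →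
    letI := rhoTopology 𝔊; ∀ (y : B7Prop1Explicit.Site S.P.d) (μ : Fin S.P.d),
      ContinuousAt (fun U : GaugeField S.P 0 G => ((avgIter L (liftCfg 𝔊 U) i y μ : (Matrix (Fin 𝔊.N) (Fin 𝔊.N) ℂ)ˣ) :
        Matrix (Fin 𝔊.N) (Fin 𝔊.N) ℂ)) U₀
  | 0, U₀, _ => by
    letI := rhoTopology 𝔊
    intro y μ
    simp only [avgIter_zero, liftCfg, MonoidHom.coe_toHomUnits]
    exact ((continuous_rho 𝔊).comp (continuous_apply _)).continuousAt
  | i + 1, U₀, h => by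
    letI := rhoTopology 𝔊
    intro y μ
    exact continuousAt_val_avgIter_succ (F := fun U : GaugeField S.P 0 G => liftCfg 𝔊 U) i
      (continuousAt_val_liftAvg i U₀ fun i' hi' => h i' (Nat.lt_succ_of_lt hi')) y μ (fun r => h i (Nat.lt_succ_self i) _ μ r)

/-- Hence the level-`i` deviation is continuous at such a configuration. [cite: Balaban1985Averaging, (42) p.23] -/
theorem continuousAt_logArgDev (i : ℕ) (U₀ : GaugeField S.P 0 G)
    (h : ∀ i' < i, ∀ (q : B7Prop1Explicit.Site S.P.d) (κ : Fin S.P.d) (r : Fin S.P.d → Fin L), logArgDev 𝔊 i' U₀ q κ r < 1)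
    (q : B7Prop1Explicit.Site S.P.d) (κ : Fin S.P.d) (r : Fin S.P.d → Fin L) :
    letI := rhoTopology 𝔊; ContinuousAt (fun U : GaugeField S.P 0 G => logArgDev 𝔊 i U q κ r) U₀ := by
  letI := rhoTopology 𝔊
  unfold logArgDev
  exact ((continuousAt_val_Wcx (F := fun U : GaugeField S.P 0 G => avgIter L (liftCfg 𝔊 U) i) (continuousAt_val_liftAvg 𝔊 i U₀ h) q κ _).sub
    continuousAt_const).norm

/-- **`hcont` BY CONSTRUCTION**: for `j < k`, every lifted `j`-fold average `U ↦ Ū^j(lift U)(z, κ)` is continuous ON the adapted class `argClass 𝔊 k`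
(at every bond, every scale, no window). [cite: Balaban1985Averaging, (42)–(43) pp.23–24] -/
theorem continuousOn_val_liftAvg_argClass {j k : ℕ} (hjk : j < k) (z : B7Prop1Explicit.Site S.P.d) (κ : Fin S.P.d) :
    letI := rhoTopology 𝔊; ContinuousOn (fun U : GaugeField S.P 0 G =>
      ((avgIter L (liftCfg 𝔊 U) j z κ : (Matrix (Fin 𝔊.N) (Fin 𝔊.N) ℂ)ˣ) : Matrix (Fin 𝔊.N) (Fin 𝔊.N) ℂ)) (argClass 𝔊 k) := by
  letI := rhoTopology 𝔊
  refine continuousOn_of_forall_continuousAt fun U₀ hU₀ => ?_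
  exact continuousAt_val_liftAvg 𝔊 j U₀ (fun i' hi' q κ' r => (hU₀ i' (hi'.trans hjk) q κ' r).trans (by norm_num)) z κ

/-! ## §3 Finitely many conditions per level (periodicity), openness and closedness by induction, `1` in the class -/

/-- The level-`i` deviations are periodic with the period of the scale-`i` torus (`i ≤ m + K`). [cite: Balaban1985Averaging, (43) p.24] -/
theorem logArgDev_add_period {i : ℕ} (hi : i ≤ S.P.m + S.P.K) (U : GaugeField S.P 0 G) (q v : B7Prop1Explicit.Site S.P.d) (κ : Fin S.P.d)
    (r : Fin S.P.d → Fin L) : logArgDev 𝔊 i U (q + (S.P.sitesPerDir i : ℤ) • v) κ r = logArgDev 𝔊 i U q κ r := by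
  unfold logArgDev
  rw [Wcx_avgIter_liftCfg_periodic 𝔊 rfl hi]

omit [MeasurableSpace G] in
/-- A property of lattice points invariant under translation by `P·ℤ^d` holds everywhere iff it holds on the box `[0, P)^d` (a finite set).
[folklore] -/
theorem forall_site_iff_box {P : ℕ} (hP : 0 < P) {f : B7Prop1Explicit.Site S.P.d → Prop}
    (hper : ∀ q v, f (q + (P : ℤ) • v) ↔ f q) :
    (∀ q, f q) ↔ ∀ q ∈ Fintype.piFinset (fun _ : Fin S.P.d => Finset.Ico (0 : ℤ) P), f q := by
  refine ⟨fun h q _ => h q, fun h q => ?_⟩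
  have hP' : (0 : ℤ) < P := by exact_mod_cast hP
  set q₀ : B7Prop1Explicit.Site S.P.d := fun κ => q κ % (P : ℤ) with hq₀
  set v : B7Prop1Explicit.Site S.P.d := fun κ => q κ / (P : ℤ) with hv
  have hq : q = q₀ + (P : ℤ) • v := by
    funext κ
    simp only [hq₀, hv, Pi.add_apply, Pi.smul_apply, smul_eq_mul]
    exact (Int.emod_add_mul_ediv (q κ) P).symm
  rw [hq, hper]
  refine h q₀ (Fintype.mem_piFinset.mpr fun κ => Finset.mem_Ico.mpr ⟨Int.emod_nonneg _ hP'.ne', Int.emod_lt_of_pos _ hP'⟩)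

/-- **THE ADAPTED CLASS IS OPEN** in the topology of the realisation, for `k ≤ m + K + 1` (induction on `k`: the level-`k` conditions are finitely many
modulo the period and continuous ON `argClass 𝔊 k`). [cite: Balaban1985Averaging, (42)–(43) pp.23–24 (topological bookkeeping)] -/
theorem isOpen_argClass : ∀ (k : ℕ), k ≤ S.P.m + S.P.K + 1 → letI := rhoTopology 𝔊; IsOpen (argClass 𝔊 k : Set (GaugeField S.P 0 G))
  | 0, _ => by
    letI := rhoTopology 𝔊
    have h0 : (argClass 𝔊 0 : Set (GaugeField S.P 0 G)) = Set.univ := by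
      ext U
      simp only [argClass, mem_setOf_eq, Nat.not_lt_zero, IsEmpty.forall_iff, implies_true, mem_univ]
    rw [h0]
    exact isOpen_univ
  | k + 1, hk => by
    letI := rhoTopology 𝔊
    have IH := isOpen_argClass k (by omega)
    have hkP : k ≤ S.P.m + S.P.K := by omega
    have hP : 0 < S.P.sitesPerDir k := Nat.pos_of_ne_zero (S.P.sitesPerDir_ne_zero k)
    have hset : (argClass 𝔊 (k + 1) : Set (GaugeField S.P 0 G)) = argClass 𝔊 k ∩
        ⋂ q ∈ Fintype.piFinset (fun _ : Fin S.P.d => Finset.Ico (0 : ℤ) (S.P.sitesPerDir k)), ⋂ (κ : Fin S.P.d), ⋂ (r : Fin S.P.d → Fin L),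
          (argClass 𝔊 k ∩ (fun U => logArgDev 𝔊 k U q κ r) ⁻¹' Set.Iio (1 / 2)) := by
      ext U
      simp only [argClass, mem_inter_iff, mem_setOf_eq, mem_iInter, mem_preimage, mem_Iio]
      constructor
      · intro hU
        have hUk : ∀ i < k, ∀ q κ r, logArgDev 𝔊 i U q κ r < 1 / 2 := fun i hi => hU i (Nat.lt_succ_of_lt hi)
        exact ⟨hUk, fun q _ κ r => ⟨hUk, hU k (Nat.lt_succ_self k) q κ r⟩⟩
      · rintro ⟨hUk, hk'⟩ i hi q κ r
        rcases Nat.lt_succ_iff_lt_or_eq.mp hi with hi' | rfl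
        · exact hUk i hi' q κ r
        · have hall : ∀ q', logArgDev 𝔊 i U q' κ r < 1 / 2 :=
            (forall_site_iff_box (S := S) hP (f := fun q' => logArgDev 𝔊 i U q' κ r < 1 / 2)
              (fun q' v => by rw [logArgDev_add_period 𝔊 hkP])).mpr fun q' hq' => (hk' q' hq' κ r).2
          exact hall q
    rw [hset]
    refine IH.inter (isOpen_biInter_finset fun q _ => isOpen_iInter_of_finite fun κ => isOpen_iInter_of_finite fun r => ?_)
    refine ContinuousOn.isOpen_inter_preimage ?_ IH isOpen_Iio
    exact continuousOn_of_forall_continuousAt fun U₀ hU₀ =>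
      (continuousAt_logArgDev 𝔊 k U₀ (fun i' hi' q' κ' r' => (hU₀ i' hi' q' κ' r').trans (by norm_num)) q κ r).continuousWithinAt
        |>.continuousAt (IH.mem_nhds hU₀)

/-- **THE ADAPTED CLOSED CLASS IS CLOSED**, for `k ≤ m + K + 1` (same induction with `ContinuousOn.preimage_isClosed_of_isClosed`).
[cite: Balaban1985Averaging, (42)–(43) pp.23–24 (topological bookkeeping)] -/
theorem isClosed_argClassC : ∀ (k : ℕ), k ≤ S.P.m + S.P.K + 1 → letI := rhoTopology 𝔊; IsClosed (argClassC 𝔊 k : Set (GaugeField S.P 0 G))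
  | 0, _ => by
    letI := rhoTopology 𝔊
    have h0 : (argClassC 𝔊 0 : Set (GaugeField S.P 0 G)) = Set.univ := by
      ext U
      simp only [argClassC, mem_setOf_eq, Nat.not_lt_zero, IsEmpty.forall_iff, implies_true, mem_univ]
    rw [h0]
    exact isClosed_univ
  | k + 1, hk => by
    letI := rhoTopology 𝔊
    have IH := isClosed_argClassC k (by omega)
    have hkP : k ≤ S.P.m + S.P.K := by omega
    have hP : 0 < S.P.sitesPerDir k := Nat.pos_of_ne_zero (S.P.sitesPerDir_ne_zero k)
    have hset : (argClassC 𝔊 (k + 1) : Set (GaugeField S.P 0 G)) = argClassC 𝔊 k ∩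
        ⋂ q ∈ Fintype.piFinset (fun _ : Fin S.P.d => Finset.Ico (0 : ℤ) (S.P.sitesPerDir k)), ⋂ (κ : Fin S.P.d), ⋂ (r : Fin S.P.d → Fin L),
          (argClassC 𝔊 k ∩ (fun U => logArgDev 𝔊 k U q κ r) ⁻¹' Set.Iic (1 / 4)) := by
      ext U
      simp only [argClassC, mem_inter_iff, mem_setOf_eq, mem_iInter, mem_preimage, mem_Iic]
      constructor
      · intro hU
        have hUk : ∀ i < k, ∀ q κ r, logArgDev 𝔊 i U q κ r ≤ 1 / 4 := fun i hi => hU i (Nat.lt_succ_of_lt hi)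
        exact ⟨hUk, fun q _ κ r => ⟨hUk, hU k (Nat.lt_succ_self k) q κ r⟩⟩
      · rintro ⟨hUk, hk'⟩ i hi q κ r
        rcases Nat.lt_succ_iff_lt_or_eq.mp hi with hi' | rfl
        · exact hUk i hi' q κ r
        · have hall : ∀ q', logArgDev 𝔊 i U q' κ r ≤ 1 / 4 :=
            (forall_site_iff_box (S := S) hP (f := fun q' => logArgDev 𝔊 i U q' κ r ≤ 1 / 4)
              (fun q' v => by rw [logArgDev_add_period 𝔊 hkP])).mpr fun q' hq' => (hk' q' hq' κ r).2
          exact hall q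
    rw [hset]
    refine IH.inter (isClosed_biInter fun q _ => isClosed_iInter fun κ => isClosed_iInter fun r => ?_)
    refine ContinuousOn.preimage_isClosed_of_isClosed ?_ IH isClosed_Iic
    exact continuousOn_of_forall_continuousAt fun U₀ hU₀ =>
      continuousAt_logArgDev 𝔊 k U₀ (fun i' hi' q' κ' r' => (hU₀ i' hi' q' κ' r').trans_lt (by norm_num)) q κ r

omit [MeasurableSpace G] in
/-- Transports of the unit configuration are `1`. [folklore] -/
theorem hol_one_cfg {H : Type*} [Group H] : ∀ (x : B7Prop1Explicit.Site S.P.d) (w : List (Letter S.P.d)),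
    hol (fun (_ : B7Prop1Explicit.Site S.P.d) (_ : Fin S.P.d) => (1 : H)) x w = 1 := by
  intro x w
  induction w generalizing x with
  | nil => rfl
  | cons l w ih =>
    rw [hol_cons, ih]
    obtain ⟨μ, b⟩ := l
    cases b <;> simp [stepHol]

/-- The lift of the unit configuration is the unit configuration. [folklore] -/
theorem liftCfg_one : liftCfg 𝔊 (1 : GaugeField S.P 0 G) = fun _ _ => 1 := by
  funext y κ
  simp only [liftCfg]
  exact map_one _

/-- **`1` LIES IN THE ADAPTED CLOSED CLASS** (`Ū^i(1) = 1`, so every deviation vanishes). [cite: Balaban1985Averaging, (43) p.24] -/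
theorem one_mem_argClassC (k : ℕ) : (1 : GaugeField S.P 0 G) ∈ argClassC 𝔊 k := by
  intro i _ q κ r
  unfold logArgDev
  have h1 : avgIter L (liftCfg 𝔊 (1 : GaugeField S.P 0 G)) i = fun _ _ => 1 := by
    rw [liftCfg_one]
    exact B7Eq92Concrete.avgIter_one L i
  rw [h1, Wcx_eq_hol_loop, hol_one_cfg]
  simp

/-- `1` lies in the adapted open class. [cite: Balaban1985Averaging, (43) p.24] -/
theorem one_mem_argClass (k : ℕ) : (1 : GaugeField S.P 0 G) ∈ argClass 𝔊 k :=
  argClassC_subset_argClass 𝔊 k (one_mem_argClassC 𝔊 k)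

end Summit.QuantumFields.YangMills.Theorems.BalabanUVNodesN08AlphaArgClass

end
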